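import Mathlib
import Literature.Computability.AlgebraicComplexity.GroupTheoreticMatMul
import Summits.MatrixMultiplication.MatrixMultiplication.Theorems.ThinPackings.Negative.TriageRuledGraphPatternedArc

/-!
# drefute evidence — `stub_boxFreiman` is TRUE (sorry-free proof of the registered signature)

Crux `ThinPackings` (stmt-MatrixMultiplication-10595), line `label-weighted-stpp-debordering`,
registered stub `stub_boxFreiman` (skeleton sha ca8354006f96…): Freiman box transfer — reduction modulo
`m > 6b` of a label-weighted family supported in `[-b, b]^D` is label-weighted with the same potentials and
cardinalities.  Proof: every clause is a signed relation of ≤ 6 box vectors (sup-norm of the combination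
≤ 6b < m), so `≡ 0 (mod m)` coordinatewise forces `= 0` in `ℤ`; the reduction is injective on the box.
Refuter seat refuter-drefute-stmt-MatrixMultiplication-10595-0, 2026-08-16 (positive lemma; candidate proof
for the lead, not landed by the refuter).
-/

set_option linter.dupNamespace false

namespace Summit.MatrixMultiplication.MatrixMultiplication.Cruxes.ThinPackings.Drefute

open Summit.MatrixMultiplication.MatrixMultiplication.Theorems.ThinPackings.Negative.Triage2
  (IsLabelWeightedSTPP)

/-- Coordinatewise reduction `ℤ^D → (ℤ/m)^D` (literally the lambda of the registered signature). -/
def red (D m : ℕ) (v : Fin D → ℤ) : Fin D → ZMod m := fun t => (v t : ZMod m)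

section RedLemmas

variable {D m : ℕ}

theorem red_sub (v w : Fin D → ℤ) : red D m (v - w) = red D m v - red D m w := by
  funext t; simp [red, Int.cast_sub]

theorem red_add (v w : Fin D → ℤ) : red D m (v + w) = red D m v + red D m w := by
  funext t; simp [red, Int.cast_add]

/-- A vector with all coordinates of absolute value `< m` that reduces to `0` is `0`. -/
theorem eq_zero_of_red_eq_zero {w : Fin D → ℤ} (hw : ∀ t, |w t| < (m : ℤ)) (h : red D m w = 0) :
    w = 0 := by
  funext t
  have ht : (w t : ZMod m) = 0 := by
    have := congrFun h t
    simpa [red] using this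
  rw [ZMod.intCast_zmod_eq_zero_iff_dvd] at ht
  exact Int.eq_zero_of_abs_lt_dvd ht (hw t)

/-- `red` is injective on the box `[-b, b]^D` once `2b < m`. -/
theorem red_injOn_box {b : ℕ} (hbm : 2 * b < m) {v w : Fin D → ℤ} (hv : ∀ t, |v t| ≤ (b : ℤ))
    (hw : ∀ t, |w t| ≤ (b : ℤ)) (h : red D m v = red D m w) : v = w := by
  have h0 : red D m (v - w) = 0 := by rw [red_sub, h, sub_self]
  have hb : ∀ t, |(v - w) t| < (m : ℤ) := by
    intro t
    have h1 := abs_le.1 (hv t)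
    have h2 := abs_le.1 (hw t)
    have hm : (2 * b : ℤ) < m := by exact_mod_cast hbm
    rw [Pi.sub_apply, abs_lt]
    constructor <;> linarith [h1.1, h1.2, h2.1, h2.2]
  exact sub_eq_zero.1 (eq_zero_of_red_eq_zero hb h0)

end RedLemmas

/-- Registered signature of `stub_boxFreiman`, verbatim. -/
def BoxFreimanTransferReg : Prop :=
  ∀ (D L b m : ℕ) (A B C : Fin L → Finset (Fin D → ℤ)) (κ μ : Fin L → ℤ), 6 * b < m → (∀ i, (∀ v ∈ A i, ∀ t, |v t| ≤ (b : ℤ)) ∧ (∀ v ∈ B i, ∀ t, |v t| ≤ (b : ℤ)) ∧ (∀ v ∈ C i, ∀ t, |v t| ≤ (b : ℤ))) → IsLabelWeightedSTPP A B C κ μ → IsLabelWeightedSTPP (fun i => (A i).image (fun (v : Fin D → ℤ) (t : Fin D) => (v t : ZMod m))) (fun i => (B i).image (fun (v : Fin D → ℤ) (t : Fin D) => (v t : ZMod m))) (fun i => (C i).image (fun (v : Fin D → ℤ) (t : Fin D) => (v t : ZMod m))) κ μ ∧ (∀ i, ((A i).image (fun (v : Fin D → ℤ) (t : Fin D) =>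 (v t : ZMod m))).card = (A i).card ∧ ((B i).image (fun (v : Fin D → ℤ) (t : Fin D) => (v t : ZMod m))).card = (B i).card ∧ ((C i).image (fun (v : Fin D → ℤ) (t : Fin D) => (v t : ZMod m))).card = (C i).card)

/-- **`stub_boxFreiman` holds.** -/
theorem boxFreimanTransfer : BoxFreimanTransferReg := by
  intro D L b m A B C κ μ hbm hbox hW
  -- the literal lambda is `red D m`
  change IsLabelWeightedSTPP (fun i => (A i).image (red D m)) (fun i => (B i).image (red D m))
      (fun i => (C i).image (red D m)) κ μ ∧
    (∀ i, ((A i).image (red D m)).card = (A i).card ∧ ((B i).image (red D m)).card = (B i).card ∧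
      ((C i).image (red D m)).card = (C i).card)
  have h2bm : 2 * b < m := by omega
  obtain ⟨h1, h2, h3, h4, h5⟩ := hW
  -- four-term lift: `p − q = p' − q'` for box vectors
  have lift4 : ∀ p q p' q' : Fin D → ℤ, (∀ t, |p t| ≤ (b : ℤ)) → (∀ t, |q t| ≤ (b : ℤ)) →
      (∀ t, |p' t| ≤ (b : ℤ)) → (∀ t, |q' t| ≤ (b : ℤ)) →
      red D m p - red D m q = red D m p' - red D m q' → p - q = p' - q' := by
    intro p q p' q' hp hq hp' hq' he
    have h0 : red D m ((p - q) - (p' - q')) = 0 := by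
      rw [red_sub, red_sub, red_sub, he, sub_self]
    have hb : ∀ t, |((p - q) - (p' - q')) t| < (m : ℤ) := by
      intro t
      have a1 := abs_le.1 (hp t); have a2 := abs_le.1 (hq t)
      have a3 := abs_le.1 (hp' t); have a4 := abs_le.1 (hq' t)
      have hm : (6 * b : ℤ) < m := by exact_mod_cast hbm
      simp only [Pi.sub_apply]
      rw [abs_lt]
      constructor <;> linarith [a1.1, a1.2, a2.1, a2.2, a3.1, a3.2, a4.1, a4.2]
    exact sub_eq_zero.1 (eq_zero_of_red_eq_zero hb h0)
  -- six-term lift: `(s' − s) + (t' − t) + (u' − u) = 0` for box vectors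
  have lift6 : ∀ s s' t t' u u' : Fin D → ℤ, (∀ r, |s r| ≤ (b : ℤ)) → (∀ r, |s' r| ≤ (b : ℤ)) →
      (∀ r, |t r| ≤ (b : ℤ)) → (∀ r, |t' r| ≤ (b : ℤ)) → (∀ r, |u r| ≤ (b : ℤ)) →
      (∀ r, |u' r| ≤ (b : ℤ)) →
      (red D m s' - red D m s) + (red D m t' - red D m t) + (red D m u' - red D m u) = 0 →
      (s' - s) + (t' - t) + (u' - u) = 0 := by
    intro s s' t t' u u' hs hs' ht ht' hu hu' he
    have h0 : red D m ((s' - s) + (t' - t) + (u' - u)) = 0 := by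
      rw [red_add, red_add, red_sub, red_sub, red_sub, he]
    have hb : ∀ r, |((s' - s) + (t' - t) + (u' - u)) r| < (m : ℤ) := by
      intro r
      have a1 := abs_le.1 (hs r); have a2 := abs_le.1 (hs' r)
      have a3 := abs_le.1 (ht r); have a4 := abs_le.1 (ht' r)
      have a5 := abs_le.1 (hu r); have a6 := abs_le.1 (hu' r)
      have hm : (6 * b : ℤ) < m := by exact_mod_cast hbm
      simp only [Pi.add_apply, Pi.sub_apply]
      rw [abs_lt]
      constructor <;>
        linarith [a1.1, a1.2, a2.1, a2.2, a3.1, a3.2, a4.1, a4.2, a5.1, a5.2, a6.1, a6.2]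
    exact eq_zero_of_red_eq_zero hb h0
  refine ⟨⟨?_, ?_, ?_, ?_, ?_⟩, ?_⟩
  · -- (1) A–B packing
    intro i k s hs t ht s' hs' t' ht' he
    simp only [Finset.mem_image] at hs ht hs' ht'
    obtain ⟨s₀, hs₀, rfl⟩ := hs
    obtain ⟨t₀, ht₀, rfl⟩ := ht
    obtain ⟨s₁, hs₁, rfl⟩ := hs'
    obtain ⟨t₁, ht₁, rfl⟩ := ht'
    have he' := lift4 s₀ t₀ s₁ t₁ ((hbox i).1 s₀ hs₀) ((hbox i).2.1 t₀ ht₀) ((hbox k).1 s₁ hs₁)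
      ((hbox k).2.1 t₁ ht₁) he
    obtain ⟨hik, hss, htt⟩ := h1 i k s₀ hs₀ t₀ ht₀ s₁ hs₁ t₁ ht₁ he'
    exact ⟨hik, by rw [hss], by rw [htt]⟩
  · -- (2) B–C packing
    intro j k t ht u hu t' ht' u' hu' he
    simp only [Finset.mem_image] at ht hu ht' hu'
    obtain ⟨t₀, ht₀, rfl⟩ := ht
    obtain ⟨u₀, hu₀, rfl⟩ := hu
    obtain ⟨t₁, ht₁, rfl⟩ := ht'
    obtain ⟨u₁, hu₁, rfl⟩ := hu'
    have he' := lift4 t₀ u₀ t₁ u₁ ((hbox j).2.1 t₀ ht₀) ((hbox j).2.2 u₀ hu₀) ((hbox k).2.1 t₁ ht₁)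
      ((hbox k).2.2 u₁ hu₁) he
    obtain ⟨hjk, htt, huu⟩ := h2 j k t₀ ht₀ u₀ hu₀ t₁ ht₁ u₁ hu₁ he'
    exact ⟨hjk, by rw [htt], by rw [huu]⟩
  · -- (3) C–A packing
    intro i k u hu s hs u' hu' s' hs' he
    simp only [Finset.mem_image] at hu hs hu' hs'
    obtain ⟨u₀, hu₀, rfl⟩ := hu
    obtain ⟨s₀, hs₀, rfl⟩ := hs
    obtain ⟨u₁, hu₁, rfl⟩ := hu'
    obtain ⟨s₁, hs₁, rfl⟩ := hs'
    have he' := lift4 u₀ s₀ u₁ s₁ ((hbox i).2.2 u₀ hu₀) ((hbox i).1 s₀ hs₀) ((hbox k).2.2 u₁ hu₁)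
      ((hbox k).1 s₁ hs₁) he
    obtain ⟨hik, huu, hss⟩ := h3 i k u₀ hu₀ s₀ hs₀ u₁ hu₁ s₁ hs₁ he'
    exact ⟨hik, by rw [huu], by rw [hss]⟩
  · -- (4) TPP
    intro i s hs s' hs' t ht t' ht' u hu u' hu' h0
    simp only [Finset.mem_image] at hs hs' ht ht' hu hu'
    obtain ⟨s₀, hs₀, rfl⟩ := hs
    obtain ⟨s₁, hs₁, rfl⟩ := hs'
    obtain ⟨t₀, ht₀, rfl⟩ := ht
    obtain ⟨t₁, ht₁, rfl⟩ := ht'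
    obtain ⟨u₀, hu₀, rfl⟩ := hu
    obtain ⟨u₁, hu₁, rfl⟩ := hu'
    have h0' := lift6 s₀ s₁ t₀ t₁ u₀ u₁ ((hbox i).1 s₀ hs₀) ((hbox i).1 s₁ hs₁)
      ((hbox i).2.1 t₀ ht₀) ((hbox i).2.1 t₁ ht₁) ((hbox i).2.2 u₀ hu₀) ((hbox i).2.2 u₁ hu₁) h0
    obtain ⟨hss, htt, huu⟩ := h4 i s₀ hs₀ s₁ hs₁ t₀ ht₀ t₁ ht₁ u₀ hu₀ u₁ hu₁ h0'
    exact ⟨by rw [hss], by rw [htt], by rw [huu]⟩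
  · -- (5) cross relations
    intro i j k hne s hs s' hs' t ht t' ht' u hu u' hu' h0
    simp only [Finset.mem_image] at hs hs' ht ht' hu hu'
    obtain ⟨s₀, hs₀, rfl⟩ := hs
    obtain ⟨s₁, hs₁, rfl⟩ := hs'
    obtain ⟨t₀, ht₀, rfl⟩ := ht
    obtain ⟨t₁, ht₁, rfl⟩ := ht'
    obtain ⟨u₀, hu₀, rfl⟩ := hu
    obtain ⟨u₁, hu₁, rfl⟩ := hu'
    have h0' := lift6 s₀ s₁ t₀ t₁ u₀ u₁ ((hbox k).1 s₀ hs₀) ((hbox i).1 s₁ hs₁)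
      ((hbox i).2.1 t₀ ht₀) ((hbox j).2.1 t₁ ht₁) ((hbox j).2.2 u₀ hu₀) ((hbox k).2.2 u₁ hu₁) h0
    exact h5 i j k hne s₀ hs₀ s₁ hs₁ t₀ ht₀ t₁ ht₁ u₀ hu₀ u₁ hu₁ h0'
  · -- cardinalities: `red` is injective on the box
    intro i
    refine ⟨Finset.card_image_of_injOn ?_, Finset.card_image_of_injOn ?_,
      Finset.card_image_of_injOn ?_⟩
    · intro v hv w hw he
      exact red_injOn_box h2bm ((hbox i).1 v hv) ((hbox i).1 w hw) he
    · intro v hv w hw he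
      exact red_injOn_box h2bm ((hbox i).2.1 v hv) ((hbox i).2.1 w hw) he
    · intro v hv w hw he
      exact red_injOn_box h2bm ((hbox i).2.2 v hv) ((hbox i).2.2 w hw) he

end Summit.MatrixMultiplication.MatrixMultiplication.Cruxes.ThinPackings.Drefute
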